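import Summits.KontsevichZagierPeriods.Zeta5Search.Denom.TwoTaleP15TopWindow
import Summits.KontsevichZagierPeriods.Zeta5Search.TwoTaleP15Slice
import Summits.KontsevichZagierPeriods.Zeta5Search.TwoTaleP15SecondTaleCrude
import Summits.KontsevichZagierPeriods.Zeta5Search.TwoTaleP15SecondTaleBCellsC
import Summits.KontsevichZagierPeriods.Zeta5Search.TwoTaleP15SecondTaleBCellsD
import Summits.KontsevichZagierPeriods.Zeta5Search.TwoTaleP15SecondTaleBCellsE
import Summits.KontsevichZagierPeriods.Zeta5Search.TwoTaleP15SecondTaleBCellsF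
import Summits.KontsevichZagierPeriods.Zeta5Search.TwoTaleP15SecondTaleBCellsG

/-!
# P15, the (bmiss)-free route W1: the normaliser `N_n = D_{17n}²·E_n²` and the eight common prime cells

HONEST FRAMING: systematic search; no irrationality claim unless certified.  Denominator side only; nothing about
ζ(2) is certified here.

Cell pub-zeta5, P1 g10 (`pub-zeta5-p1/TWODECAY-ROUTE-g10.md`; fam-denom `families/denom/P15KERNEL.md` §10).
The route W1 to the eventual two-tale coincidence `p_n = −p̂_n` uses, instead of `D₁₆ₙD₁₅ₙ p̂_n ∈ ℤ`
(`IntegralT`, not in print), the WEAKER normaliser `N_n := D_{17n}·D_{17n}·E_n²` (`E_n = lcm(1..⌊√26n⌋)⁶`,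
fam-denom's `fudge`), rate `34 + o(1)`, for which `N_n·p̂_n ∈ ℤ` IS a theorem (this file,
`exists_int_bigN_mul_formPT`): prime by prime, `p > 17n` by the slice lemma (`TwoTaleP15Slice`), `√26n < p ≤ 17n`
by the free bound `‖p̂_n‖_p ≤ p²`, `p ≤ √26n` by the crude bound `‖p̂_n‖_p ≤ p^{3⌊log_p 33n⌋}`
(`TwoTaleP15SecondTaleCrude`) against `‖E_n²‖_p = p^{−12⌊log_p √26n⌋}`.  The extra rate `3` is paid by EIGHT
COMMON prime cells of `{n/p}` (`26n < p²`, `p ≤ 15n`) on which BOTH `D₁₆ₙD₁₅ₙp_n` (first tale, tree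
`ivl_1_left/ivl_2/ivl_11/ivl_12/ivl_13`) and `N_n p̂_n` (second tale: `phat_ivl_9_EZ`, `phat_cell_*`) gain
`p^ℓ`: `[1/11,2/17)¹, [2/17,3/17)¹, [2/11,1/5)², [1/5,3/13)¹, [3/11,5/17)², [5/17,4/13)¹, [4/13,6/17)¹, [4/11,5/13)²`
(`pow_dvd_sum_*`).  The products, rates and the squeeze are in `TwoTaleP15CoincidenceW1.lean`.
-/

noncomputable section

open Finset
open Literature.NumberTheory.Irrationality.Zudilin2014
open Literature.NumberTheory.Transcendental (OddZeta.dvd_lcmUpto)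
open Literature.NumberTheory.Transcendental.Zudilin2004 (padicValNat_lcmUpto)
open Summit.KontsevichZagierPeriods.Zeta5Search.TwoTaleP15
open Summit.KontsevichZagierPeriods.Zeta5Search.Denom.TwoTaleP15Forms (lcmNormaliser lcmNormaliser_pos)
open Summit.KontsevichZagierPeriods.Zeta5Search.Denom.TwoTaleP15TopWindow (fudge fudge_pos padicNorm_lcmUpto_le)

namespace Summit.KontsevichZagierPeriods.Zeta5Search.TwoTaleP15CommonCells

/-! ### The normaliser -/

/-- **`N_n = D_{17n}·D_{17n}·E_n²`**, `E_n = lcm(1..⌊√26n⌋)⁶` (`fudge`). -/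
def bigN (n : ℕ) : ℕ := Nat.lcmUpto (17 * n) * Nat.lcmUpto (17 * n) * (fudge n * fudge n)

/-- `N_n > 0`. -/
theorem bigN_pos (n : ℕ) : 0 < bigN n :=
  Nat.mul_pos (Nat.mul_pos (Nat.lcmUpto_pos _) (Nat.lcmUpto_pos _)) (Nat.mul_pos (fudge_pos n) (fudge_pos n))

/-- `D₁₆ₙD₁₅ₙ ∣ D₁₇ₙD₁₇ₙ`. -/
theorem lcmNormaliser_dvd (n : ℕ) : (lcmNormaliser n : ℤ) ∣ ((Nat.lcmUpto (17 * n) * Nat.lcmUpto (17 * n) : ℕ) : ℤ) := by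
  rw [Denom.TwoTaleP15Forms.lcmNormaliser]; push_cast
  exact mul_dvd_mul (lcmUpto_dvd_lcmUpto_int (by omega)) (lcmUpto_dvd_lcmUpto_int (by omega))

/-- `D₁₆ₙD₁₅ₙ ∣ N_n`. -/
theorem lcmNormaliser_dvd_bigN (n : ℕ) : (lcmNormaliser n : ℤ) ∣ (bigN n : ℤ) := by
  rw [bigN, Nat.cast_mul]; exact (lcmNormaliser_dvd n).mul_right _

/-- The quotient `Q_n = N_n / (D₁₆ₙD₁₅ₙ)`. -/
def quot (n : ℕ) : ℕ := bigN n / lcmNormaliser n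

/-- `Q_n · D₁₆ₙD₁₅ₙ = N_n`. -/
theorem quot_mul (n : ℕ) : (quot n : ℤ) * lcmNormaliser n = bigN n := by
  have h : lcmNormaliser n ∣ bigN n := by exact_mod_cast lcmNormaliser_dvd_bigN n
  rw [quot]; exact_mod_cast Nat.div_mul_cancel h

/-! ### Integrality tools -/

/-- A rational all of whose `p`-adic norms are `≤ 1` is an integer. -/
theorem exists_int_of_padicNorm_le_one {q : ℚ} (h : ∀ p : ℕ, p.Prime → padicNorm p q ≤ 1) :
    ∃ z : ℤ, q = z := by
  by_cases hden : q.den = 1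
  · exact ⟨q.num, (Rat.coe_int_num_of_den_eq_one hden).symm⟩
  exfalso
  set p := q.den.minFac with hp_def
  have hp : p.Prime := Nat.minFac_prime hden
  haveI := Fact.mk hp
  have hpd : p ∣ q.den := Nat.minFac_dvd _
  have hq0 : q ≠ 0 := by rintro rfl; exact hden rfl
  have hnum : ¬ (p : ℤ) ∣ q.num := by
    intro hd
    have h1 : p ∣ q.num.natAbs := Int.natCast_dvd.1 hd
    have h2 : p ∣ Nat.gcd q.num.natAbs q.den := Nat.dvd_gcd h1 hpd
    rw [q.reduced, Nat.dvd_one] at h2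
    exact hp.one_lt.ne' h2
  have hv : padicValRat p q ≤ -1 := by
    rw [padicValRat_def, padicValInt.eq_zero_of_not_dvd hnum]
    have := one_le_padicValNat_of_dvd q.den_nz hpd
    omega
  have hnorm : (p : ℚ) ≤ padicNorm p q := by
    rw [padicNorm.eq_zpow_of_nonzero hq0]
    calc (p : ℚ) = (p : ℚ) ^ (1 : ℤ) := (zpow_one _).symm
      _ ≤ (p : ℚ) ^ (-padicValRat p q) :=
          zpow_le_zpow_right₀ (by exact_mod_cast hp.one_lt.le) (by omega)
  have hp1 : (1 : ℚ) < p := by exact_mod_cast hp.one_lt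
  linarith [h p hp]

/-- `‖lcm(1..M)‖_p = p^{−⌊log_p M⌋}`. -/
theorem padicNorm_lcmUpto_eq {p M : ℕ} [hp : Fact p.Prime] :
    padicNorm p ((Nat.lcmUpto M : ℕ) : ℚ) = (p : ℚ) ^ (-(Nat.log p M : ℤ)) := by
  rw [padicNorm.eq_zpow_of_nonzero (by exact_mod_cast (Nat.lcmUpto_pos M).ne'), padicValRat.of_nat,
    padicValNat_lcmUpto]

/-- The small-prime exponent inequality: for a prime `p ≤ ⌊√26n⌋`, `3⌊log_p 33n⌋ ≤ 12⌊log_p ⌊√26n⌋⌋`. -/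
theorem three_log_le {n p : ℕ} (hp : p.Prime) (hn : 1 ≤ n) (hps : p ≤ Nat.sqrt (26 * n)) :
    3 * Nat.log p (33 * n) ≤ 12 * Nat.log p (Nat.sqrt (26 * n)) := by
  set s := Nat.sqrt (26 * n) with hs
  set b := Nat.log p s with hb
  have hb1 : 1 ≤ b := Nat.log_pos hp.one_lt hps
  have h1 : s < p ^ (b + 1) := Nat.lt_pow_succ_log_self hp.one_lt s
  have h2 : 26 * n < (s + 1) ^ 2 := Nat.lt_succ_sqrt' (26 * n)
  have h3 : (s + 1) ^ 2 ≤ (p ^ (b + 1)) ^ 2 := Nat.pow_le_pow_left h1 2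
  have h4 : 33 * n < p ^ (2 * b + 3) := by
    have e : p ^ (2 * b + 3) = p * (p ^ (b + 1)) ^ 2 := by ring
    rw [e]
    have := hp.two_le
    nlinarith
  have h5 : Nat.log p (33 * n) < 2 * b + 3 := (Nat.log_lt_iff_lt_pow hp.one_lt (by omega)).2 h4
  omega

/-! ### `N_n · p̂_n ∈ ℤ` -/

/-- **Every `p`-adic norm of `N_n p̂_n` is `≤ 1`.** -/
theorem padicNorm_bigN_mul_formPT_le_one {n : ℕ} (hn : 1 ≤ n) {p : ℕ} (hp : p.Prime) :
    padicNorm p ((bigN n : ℚ) * formPT (aT n) (bT n)) ≤ 1 := by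
  haveI := Fact.mk hp
  have hp0 : (p : ℚ) ≠ 0 := by exact_mod_cast hp.ne_zero
  have hp1 : (1 : ℚ) ≤ p := by exact_mod_cast hp.one_lt.le
  have hD1 : padicNorm p ((Nat.lcmUpto (17 * n) : ℕ) : ℚ) ≤ 1 := padicNorm.of_nat _
  have hF1 : padicNorm p ((fudge n : ℕ) : ℚ) ≤ 1 := padicNorm.of_nat _
  have hsplit : padicNorm p ((bigN n : ℚ) * formPT (aT n) (bT n))
      = padicNorm p ((Nat.lcmUpto (17 * n) : ℕ) : ℚ) * padicNorm p ((Nat.lcmUpto (17 * n) : ℕ) : ℚ)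
        * (padicNorm p ((fudge n : ℕ) : ℚ) * padicNorm p ((fudge n : ℕ) : ℚ))
        * padicNorm p (formPT (aT n) (bT n)) := by
    rw [bigN]; push_cast
    rw [padicNorm.mul, padicNorm.mul, padicNorm.mul, padicNorm.mul]
  rw [hsplit]
  have hnn := padicNorm.nonneg (p := p)
  rcases lt_or_ge (17 * n) p with h17 | h17
  · -- large primes: the slice lemma
    have hT := padicNorm_formPT_le_one_of_gt (p := p) hn h17
    calc _ ≤ 1 * 1 * (1 * 1) * 1 :=
          mul_le_mul (mul_le_mul (mul_le_mul hD1 hD1 (hnn _) zero_le_one) (mul_le_mul hF1 hF1 (hnn _) zero_le_one)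
            (mul_nonneg (hnn _) (hnn _)) (by norm_num)) hT (hnn _) (by positivity)
      _ = 1 := by ring
  rcases lt_or_ge (Nat.sqrt (26 * n)) p with hs | hs
  · -- middle primes: `26n < p²`, the free bound `p²` against `D_{17n}²`
    have hp2 : 26 * n < p ^ 2 := Nat.sqrt_lt'.1 hs
    have hD := padicNorm_lcmUpto_le (p := p) (M := 17 * n) h17
    have hT := padicNorm_formPT_le_sq (p := p) hn hp2
    calc _ ≤ (p : ℚ) ^ (-(1 : ℤ)) * (p : ℚ) ^ (-(1 : ℤ)) * (1 * 1) * (p : ℚ) ^ (2 : ℤ) :=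
          mul_le_mul (mul_le_mul (mul_le_mul hD hD (hnn _) (by positivity)) (mul_le_mul hF1 hF1 (hnn _) zero_le_one)
            (mul_nonneg (hnn _) (hnn _)) (by positivity)) hT (hnn _) (by positivity)
      _ = 1 := by rw [mul_one, mul_one, ← zpow_add₀ hp0, ← zpow_add₀ hp0]; norm_num
  · -- small primes: the crude bound against `E_n²`
    have hT := padicNorm_formPT_le_log (p := p) hn
    have hE : padicNorm p ((fudge n : ℕ) : ℚ) = (p : ℚ) ^ (-(6 * (Nat.log p (Nat.sqrt (26 * n)) : ℤ))) := by
      rw [Denom.TwoTaleP15TopWindow.fudge, Nat.cast_pow, show (6 : ℕ) = 1 + 1 + 1 + 1 + 1 + 1 from rfl]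
      simp only [pow_succ, pow_zero, one_mul, padicNorm.mul, padicNorm_lcmUpto_eq, ← zpow_add₀ hp0]
      congr 1; ring
    have h3 := three_log_le hp hn hs
    calc _ ≤ 1 * 1 * ((p : ℚ) ^ (-(6 * (Nat.log p (Nat.sqrt (26 * n)) : ℤ)))
            * (p : ℚ) ^ (-(6 * (Nat.log p (Nat.sqrt (26 * n)) : ℤ)))) * (p : ℚ) ^ (3 * Nat.log p (33 * n)) := by
          rw [hE]
          exact mul_le_mul (mul_le_mul (mul_le_mul hD1 hD1 (hnn _) zero_le_one) le_rfl (by positivity)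
            (by norm_num)) hT (hnn _) (by positivity)
      _ = (p : ℚ) ^ ((3 * Nat.log p (33 * n) : ℕ) - (12 * (Nat.log p (Nat.sqrt (26 * n)) : ℤ)) : ℤ) := by
          rw [one_mul, one_mul, ← zpow_natCast, ← zpow_add₀ hp0, ← zpow_add₀ hp0]; congr 1; ring
      _ ≤ 1 := zpow_le_one_of_nonpos₀ hp1 (by push_cast; omega)

/-- **`N_n · p̂_n ∈ ℤ` for every `n ≥ 1`** (the W1 replacement of `IntegralT`). -/
theorem exists_int_bigN_mul_formPT {n : ℕ} (hn : 1 ≤ n) :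
    ∃ z : ℤ, (bigN n : ℚ) * formPT (aT n) (bT n) = z :=
  exists_int_of_padicNorm_le_one fun _ hp => padicNorm_bigN_mul_formPT_le_one hn hp

/-! ### The common cells: `p^ℓ ∣ Q_n·D₁₆ₙD₁₅ₙp_n + N_n p̂_n` -/

/-- Generic cell step: a class prime `p ≤ 15n`, `26n < p²`, with `p^ℓ ∣ D₁₆ₙD₁₅ₙ p_n` (first tale) and
`‖p̂_n‖_p ≤ p^{2−ℓ}` (second tale) divides `Q_n·pP15num n + z`, `z = N_n p̂_n`, to order `ℓ`. -/
theorem pow_dvd_sum_of_tales {n p ℓ : ℕ} (hp : p.Prime) (hp15 : p ≤ 15 * n)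
    (hP : (p : ℤ) ^ ℓ ∣ pP15num n)
    (hT : @padicNorm p (formPT (aT n) (bT n)) ≤ (p : ℚ) ^ (2 - ℓ : ℤ))
    {z : ℤ} (hz : (bigN n : ℚ) * formPT (aT n) (bT n) = z) :
    (p : ℤ) ^ ℓ ∣ (quot n : ℤ) * pP15num n + z := by
  haveI := Fact.mk hp
  have hp0 : (p : ℚ) ≠ 0 := by exact_mod_cast hp.ne_zero
  have hnn := padicNorm.nonneg (p := p)
  refine dvd_add (hP.mul_left _) ?_
  have hD := padicNorm_lcmUpto_le (p := p) (M := 17 * n) (by omega)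
  have hF1 : padicNorm p ((fudge n : ℕ) : ℚ) ≤ 1 := padicNorm.of_nat _
  have hnorm : padicNorm p (z : ℚ) ≤ (p : ℚ) ^ (-(ℓ : ℤ)) := by
    rw [← hz, bigN]; push_cast
    rw [padicNorm.mul, padicNorm.mul, padicNorm.mul, padicNorm.mul]
    calc _ ≤ (p : ℚ) ^ (-(1 : ℤ)) * (p : ℚ) ^ (-(1 : ℤ)) * (1 * 1) * (p : ℚ) ^ (2 - ℓ : ℤ) :=
          mul_le_mul (mul_le_mul (mul_le_mul hD hD (hnn _) (by positivity)) (mul_le_mul hF1 hF1 (hnn _) zero_le_one)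
            (mul_nonneg (hnn _) (hnn _)) (by positivity)) hT (hnn _) (by positivity)
      _ = (p : ℚ) ^ (-(ℓ : ℤ)) := by rw [mul_one, mul_one, ← zpow_add₀ hp0, ← zpow_add₀ hp0]; congr 1; ring
  exact_mod_cast (padicNorm.dvd_iff_norm_le (p := p) (n := ℓ) (z := z)).2 hnorm

variable {n p : ℕ}

/-- Cell `[1/11, 2/17)` (= `ivl 9`), level 1: first tale `ivl_1_left`, second tale `phat_ivl_9_EZ` (`E ≥ 2`). -/
theorem pow_dvd_sum_cell9 (hn : 1 ≤ n) (hp : p.Prime) (hp2 : 26 * n < p ^ 2)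
    (h1 : (1 / 11 : ℝ) ≤ Int.fract ((n : ℝ) / p)) (h2 : Int.fract ((n : ℝ) / p) < 2 / 17)
    {z : ℤ} (hz : (bigN n : ℚ) * formPT (aT n) (bT n) = z) : (p : ℤ) ^ 1 ∣ (quot n : ℤ) * pP15num n + z := by
  haveI := Fact.mk hp
  obtain ⟨hu, hv⟩ := mod_bounds_of_fract (U₁ := 1) (U₂ := 11) (V₁ := 2) (V₂ := 17) hp.pos
    (by norm_num) (by norm_num) (by exact_mod_cast h1) (by exact_mod_cast h2)
  have hmod : n % p ≤ n := Nat.mod_le n p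
  have hu' : (1 : ℤ) * p ≤ 11 * ((n : ℤ) % p) := by rw [← Int.natCast_mod]; exact_mod_cast hu
  have hv' : (17 : ℤ) * ((n : ℤ) % p) < 2 * p := by rw [← Int.natCast_mod]; exact_mod_cast hv
  refine pow_dvd_sum_of_tales hp (by omega) (ivl_1_left hn hp hp2 h1 (h2.trans (by norm_num))).2 ?_ hz
  refine (padicNorm_formPT_le hn hp2 (e := 2) fun k _ _ => phat_ivl_9_EZ hp hu' hv' k).trans ?_
  exact zpow_le_zpow_right₀ (by exact_mod_cast hp.one_lt.le) (by norm_num)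

/-- Cell `[2/17, 3/17)`, level 1: `ivl_1_left` and `phat_cell_2_17`. -/
theorem pow_dvd_sum_cellC (hn : 1 ≤ n) (hp : p.Prime) (hp2 : 26 * n < p ^ 2)
    (h1 : (2 / 17 : ℝ) ≤ Int.fract ((n : ℝ) / p)) (h2 : Int.fract ((n : ℝ) / p) < 3 / 17)
    {z : ℤ} (hz : (bigN n : ℚ) * formPT (aT n) (bT n) = z) : (p : ℤ) ^ 1 ∣ (quot n : ℤ) * pP15num n + z := by
  haveI := Fact.mk hp
  obtain ⟨hu, -⟩ := mod_bounds_of_fract (U₁ := 2) (U₂ := 17) (V₁ := 3) (V₂ := 17) hp.pos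
    (by norm_num) (by norm_num) (by exact_mod_cast h1) (by exact_mod_cast h2)
  have hmod : n % p ≤ n := Nat.mod_le n p
  exact pow_dvd_sum_of_tales hp (by omega)
    (ivl_1_left hn hp hp2 ((show (1 / 11 : ℝ) ≤ 2 / 17 by norm_num).trans h1) (h2.trans (by norm_num))).2
    (phat_cell_2_17 hn hp2 h1 h2) hz

/-- Cell `[2/11, 1/5)` (= `ivl 11`), level 2: `ivl_11` and `phat_cell_2_11`. -/
theorem pow_dvd_sum_cell11 (hn : 1 ≤ n) (hp : p.Prime) (hp2 : 26 * n < p ^ 2)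
    (h1 : (2 / 11 : ℝ) ≤ Int.fract ((n : ℝ) / p)) (h2 : Int.fract ((n : ℝ) / p) < 1 / 5)
    {z : ℤ} (hz : (bigN n : ℚ) * formPT (aT n) (bT n) = z) : (p : ℤ) ^ 2 ∣ (quot n : ℤ) * pP15num n + z := by
  haveI := Fact.mk hp
  obtain ⟨hu, -⟩ := mod_bounds_of_fract (U₁ := 2) (U₂ := 11) (V₁ := 1) (V₂ := 5) hp.pos
    (by norm_num) (by norm_num) (by exact_mod_cast h1) (by exact_mod_cast h2)
  have hmod : n % p ≤ n := Nat.mod_le n p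
  exact pow_dvd_sum_of_tales hp (by omega) (ivl_11 hn hp hp2 h1 h2).2 (phat_cell_2_11 hn hp2 h1 h2) hz

/-- Cell `[1/5, 3/13)`, level 1: `ivl_1_left` and `phat_cell_1_5`. -/
theorem pow_dvd_sum_cellTc (hn : 1 ≤ n) (hp : p.Prime) (hp2 : 26 * n < p ^ 2)
    (h1 : (1 / 5 : ℝ) ≤ Int.fract ((n : ℝ) / p)) (h2 : Int.fract ((n : ℝ) / p) < 3 / 13)
    {z : ℤ} (hz : (bigN n : ℚ) * formPT (aT n) (bT n) = z) : (p : ℤ) ^ 1 ∣ (quot n : ℤ) * pP15num n + z := by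
  haveI := Fact.mk hp
  obtain ⟨hu, -⟩ := mod_bounds_of_fract (U₁ := 1) (U₂ := 5) (V₁ := 3) (V₂ := 13) hp.pos
    (by norm_num) (by norm_num) (by exact_mod_cast h1) (by exact_mod_cast h2)
  have hmod : n % p ≤ n := Nat.mod_le n p
  exact pow_dvd_sum_of_tales hp (by omega)
    (ivl_1_left hn hp hp2 ((show (1 / 11 : ℝ) ≤ 1 / 5 by norm_num).trans h1) h2).2 (phat_cell_1_5 hn hp2 h1 h2) hz

/-- Cell `[3/11, 5/17)` (⊂ `ivl 12`), level 2: `ivl_12` and `phat_cell_3_11`. -/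
theorem pow_dvd_sum_cellTd (hn : 1 ≤ n) (hp : p.Prime) (hp2 : 26 * n < p ^ 2)
    (h1 : (3 / 11 : ℝ) ≤ Int.fract ((n : ℝ) / p)) (h2 : Int.fract ((n : ℝ) / p) < 5 / 17)
    {z : ℤ} (hz : (bigN n : ℚ) * formPT (aT n) (bT n) = z) : (p : ℤ) ^ 2 ∣ (quot n : ℤ) * pP15num n + z := by
  haveI := Fact.mk hp
  obtain ⟨hu, -⟩ := mod_bounds_of_fract (U₁ := 3) (U₂ := 11) (V₁ := 5) (V₂ := 17) hp.pos
    (by norm_num) (by norm_num) (by exact_mod_cast h1) (by exact_mod_cast h2)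
  have hmod : n % p ≤ n := Nat.mod_le n p
  exact pow_dvd_sum_of_tales hp (by omega) (ivl_12 hn hp hp2 h1 (h2.trans (by norm_num))).2
    (phat_cell_3_11 hn hp2 h1 h2) hz

/-- Cell `[5/17, 4/13)` (⊂ `ivl 2`), level 1: `ivl_2` and `phat_cell_5_17`. -/
theorem pow_dvd_sum_cellTg (hn : 1 ≤ n) (hp : p.Prime) (hp2 : 26 * n < p ^ 2)
    (h1 : (5 / 17 : ℝ) ≤ Int.fract ((n : ℝ) / p)) (h2 : Int.fract ((n : ℝ) / p) < 4 / 13)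
    {z : ℤ} (hz : (bigN n : ℚ) * formPT (aT n) (bT n) = z) : (p : ℤ) ^ 1 ∣ (quot n : ℤ) * pP15num n + z := by
  haveI := Fact.mk hp
  obtain ⟨hu, -⟩ := mod_bounds_of_fract (U₁ := 5) (U₂ := 17) (V₁ := 4) (V₂ := 13) hp.pos
    (by norm_num) (by norm_num) (by exact_mod_cast h1) (by exact_mod_cast h2)
  have hmod : n % p ≤ n := Nat.mod_le n p
  exact pow_dvd_sum_of_tales hp (by omega)
    (ivl_2 hn hp hp2 ((show (3 / 11 : ℝ) ≤ 5 / 17 by norm_num).trans h1) (h2.trans (by norm_num))).2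
    (phat_cell_5_17 hn hp2 h1 h2) hz

/-- Cell `[4/13, 6/17)` (⊂ `ivl 2`), level 1: `ivl_2` and `phat_cell_4_13`. -/
theorem pow_dvd_sum_cellTe (hn : 1 ≤ n) (hp : p.Prime) (hp2 : 26 * n < p ^ 2)
    (h1 : (4 / 13 : ℝ) ≤ Int.fract ((n : ℝ) / p)) (h2 : Int.fract ((n : ℝ) / p) < 6 / 17)
    {z : ℤ} (hz : (bigN n : ℚ) * formPT (aT n) (bT n) = z) : (p : ℤ) ^ 1 ∣ (quot n : ℤ) * pP15num n + z := by
  haveI := Fact.mk hp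
  obtain ⟨hu, -⟩ := mod_bounds_of_fract (U₁ := 4) (U₂ := 13) (V₁ := 6) (V₂ := 17) hp.pos
    (by norm_num) (by norm_num) (by exact_mod_cast h1) (by exact_mod_cast h2)
  have hmod : n % p ≤ n := Nat.mod_le n p
  exact pow_dvd_sum_of_tales hp (by omega)
    (ivl_2 hn hp hp2 ((show (3 / 11 : ℝ) ≤ 4 / 13 by norm_num).trans h1) (h2.trans (by norm_num))).2
    (phat_cell_4_13 hn hp2 h1 h2) hz

/-- Cell `[4/11, 5/13)` (= `ivl 13`), level 2: `ivl_13` and `phat_cell_4_11`. -/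
theorem pow_dvd_sum_cellTf (hn : 1 ≤ n) (hp : p.Prime) (hp2 : 26 * n < p ^ 2)
    (h1 : (4 / 11 : ℝ) ≤ Int.fract ((n : ℝ) / p)) (h2 : Int.fract ((n : ℝ) / p) < 5 / 13)
    {z : ℤ} (hz : (bigN n : ℚ) * formPT (aT n) (bT n) = z) : (p : ℤ) ^ 2 ∣ (quot n : ℤ) * pP15num n + z := by
  haveI := Fact.mk hp
  obtain ⟨hu, -⟩ := mod_bounds_of_fract (U₁ := 4) (U₂ := 11) (V₁ := 5) (V₂ := 13) hp.pos
    (by norm_num) (by norm_num) (by exact_mod_cast h1) (by exact_mod_cast h2)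
  have hmod : n % p ≤ n := Nat.mod_le n p
  exact pow_dvd_sum_of_tales hp (by omega) (ivl_13 hn hp hp2 h1 h2).2 (phat_cell_4_11 hn hp2 h1 h2) hz

end Summit.KontsevichZagierPeriods.Zeta5Search.TwoTaleP15CommonCells

end
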